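import Literature.Geometry.Kaehler.TorusDolbeaultRegularityCases
import Literature.Geometry.Kaehler.TorusDolbeaultRegularityGlobal
import Literature.Geometry.Kaehler.TorusDolbeaultCompactAll
import Literature.NumberTheory.Transcendental.KaehlerHodgeAdjointProofs
import Mathlib.Analysis.InnerProductSpace.Dual
import HarnessLib

/-!
# Warner's regularity theorem 6.5 for `Δ_∂̄` on `A^{p,q}(M)` (weak solutions are smooth)

F. W. Warner, GTM 94 (1983), Thm. 6.5 / 6.32, for the `∂̄`-Laplacian of a compact Hermitian
manifold: a bounded weak solution `ℓ` of `Δ_∂̄ w = α` (`ℓ(Δ_∂̄ φ) = ⟪α, φ⟫`) is represented by a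
smooth form, `ℓ(φ) = ⟪w, φ⟫`. Assembled from the local representation
(`CL2SmoothForms.exists_local_repr_dolbeault*`) and the gluing
(`CL2SmoothForms.exists_global_repr_of_local`) in every degree, the degenerate dimension `n = 0`
being finite-dimensional; then restricted to the forms of type `(p,q)` through the `L²`-bounded type
projection (types are `L²`-orthogonal for a Hermitian metric; the projection is built inside the proof). The result `CL2SmoothForms.pq_regular`
is the regularity hypothesis `hR` of the elliptic reduction of the Frölicher inequality.

## References

* F. W. Warner, GTM 94 (1983), Thm. 6.5, 6.32. [WarnerGTM94]
* C. Voisin, Hodge Theory and Complex Algebraic Geometry I (2002), §5.1. [VoisinHodgeI2002]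
-/

noncomputable section

open scoped Manifold ContDiff Topology NNReal ENNReal ComplexConjugate ComplexInnerProductSpace
open Bundle Set Function Module Filter Complex Finset
open Literature.NumberTheory.Transcendental

namespace Literature.Geometry.Kaehler

variable {E : Type*} [NormedAddCommGroup E] [NormedSpace ℂ E] [FiniteDimensional ℂ E]
  {n : ℕ} [Fact (finrank ℝ E = n)] [MeasurableSpace E] [BorelSpace E]
  {M : Type*} [TopologicalSpace M] [ChartedSpace E M] [T2Space M] [CompactSpace M]
  [IsManifold 𝓘(ℂ, E) ω M] [IsManifold 𝓘(ℝ, E) ∞ M]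
  [RiemannianBundle (fun x : M ↦ TangentSpace 𝓘(ℝ, E) x)]
  [IsContMDiffRiemannianBundle 𝓘(ℝ, E) ∞ E (fun x : M ↦ TangentSpace 𝓘(ℝ, E) x)]
  (o : (x : M) → Orientation ℝ (TangentSpace 𝓘(ℝ, E) x) (Fin n)) {k m : ℕ}
  [Fact (IsSmoothForm (riemannianVolumeForm o))]

/-! ### Regularity in every degree -/

omit [IsManifold 𝓘(ℂ, E) ω M] in
/-- In dimension `0` every bounded functional on `A^k(M; ℂ)` is represented (finite-dimensional
Riesz). [folklore] -/
theorem CL2SmoothForms.regular_of_finrank_zero (hn : n = 0) {j : ℕ} (ℓ : CL2SmoothForms o j →L[ℂ] ℂ) :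
    ∃ w : CL2SmoothForms o j, ∀ φ, ℓ φ = ⟪w, φ⟫ := by
  haveI := CL2SmoothForms.finiteDimensional_of_finrank_zero o hn j
  haveI : CompleteSpace (CL2SmoothForms o j) := FiniteDimensional.complete ℂ _
  exact ⟨(InnerProductSpace.toDual ℂ (CL2SmoothForms o j)).symm ℓ, fun φ ↦ by
    rw [InnerProductSpace.toDual_symm_apply]⟩

omit [IsManifold 𝓘(ℂ, E) ω M] in
/-- From a global smooth representative on smooth forms to the pre-Hilbert statement. [folklore] -/
theorem CL2SmoothForms.regular_of_repr {j : ℕ} (ℓ : CL2SmoothForms o j →L[ℂ] ℂ)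
    (h : ∃ (w : MForm 𝓘(ℝ, E) M ℂ j) (hw : IsSmoothForm w), ∀ (t : MForm 𝓘(ℝ, E) M ℂ j) (ht : IsSmoothForm t),
      ℓ (CL2SmoothForms.mk o t ht) = ⟪CL2SmoothForms.mk o w hw, CL2SmoothForms.mk o t ht⟫) :
    ∃ w : CL2SmoothForms o j, ∀ φ, ℓ φ = ⟪w, φ⟫ := by
  obtain ⟨w, hw, hrep⟩ := h
  exact ⟨CL2SmoothForms.mk o w hw, fun φ ↦ by rw [← CL2SmoothForms.mk_toForm o φ]; exact hrep _ _⟩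

/-- **Warner's Theorem 6.5 for `Δ_∂̄` in every degree** `K + m = n` (Hermitian metric): a bounded
weak solution `ℓ(Δ_∂̄ φ) = ⟪α, φ⟫` on `A^K(M; ℂ)` is represented, `ℓ = ⟪w, ·⟫`. [cite: WarnerGTM94, Thm. 6.5] -/
theorem CL2SmoothForms.dolbeaultLaplacian_regular_all
    (hH : ∀ (x : M) (v w : TangentSpace 𝓘(ℝ, E) x), inner ℝ (tangentJ E x v) (tangentJ E x w) = inner ℝ v w) :
    ∀ (K m : ℕ) (h : K + m = n) (α : CL2SmoothForms o K) (ℓ : CL2SmoothForms o K →L[ℂ] ℂ),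
      (∀ φ, ℓ (CL2SmoothForms.dolbeaultLaplacian o h φ) = ⟪α, φ⟫) → ∃ w : CL2SmoothForms o K, ∀ φ, ℓ φ = ⟪w, φ⟫
  | 0, 0, h, _, ℓ, _ => CL2SmoothForms.regular_of_finrank_zero o (by omega) ℓ
  | 0, m + 1, h, α, ℓ, hweak => CL2SmoothForms.regular_of_repr o ℓ
      (CL2SmoothForms.exists_global_repr_of_local o ℓ fun p ↦
        CL2SmoothForms.exists_local_repr_dolbeault_zero o hH h p α ℓ hweak)
  | K + 1, 0, h, α, ℓ, hweak => CL2SmoothForms.regular_of_repr o ℓ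
      (CL2SmoothForms.exists_global_repr_of_local o ℓ fun p ↦
        CL2SmoothForms.exists_local_repr_dolbeault_top o hH h p α ℓ hweak)
  | K + 1, m + 1, h, α, ℓ, hweak => CL2SmoothForms.regular_of_repr o ℓ
      (CL2SmoothForms.exists_global_repr_of_local o ℓ fun p ↦
        CL2SmoothForms.exists_local_repr_dolbeault o hH h p α ℓ hweak)

/-! ### The type projection and the restriction to `A^{p,q}` -/

/-- **Types are `L²`-orthogonal**: `⟪α, φ⟫ = ⟪α, φ^{p,q}⟫` for `α` of type `(p,q)` (Hermitian metric;
the other type components of `φ` have other rotation weights). [cite: VoisinHodgeI2002, §5.1.1] -/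
theorem CL2SmoothForms.inner_eq_inner_typeComponent
    (hH : ∀ (x : M) (v w : TangentSpace 𝓘(ℝ, E) x), inner ℝ (tangentJ E x v) (tangentJ E x w) = inner ℝ v w)
    {p q : ℕ} (h : (p + q) + m = n) {α : CL2SmoothForms o (p + q)} (hα : α ∈ CL2SmoothForms.pq o p q)
    (φ : CL2SmoothForms o (p + q)) :
    ⟪α, φ⟫ = ⟪α, CL2SmoothForms.mk o ((CL2SmoothForms.toForm o φ).typeComponent p q)
      ((CL2SmoothForms.isSmoothForm_toForm o φ).typeComponent p q)⟫ := by
  have ho : IsSmoothForm (riemannianVolumeForm o) := Fact.out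
  haveI : IsContinuousRiemannianBundle E (fun x : M ↦ TangentSpace 𝓘(ℝ, E) x) :=
    isContinuousRiemannianBundle_of_isContMDiffRiemannianBundle 𝓘(ℝ, E) ∞
  rw [CL2SmoothForms.mem_pq_iff] at hα
  have hαs := CL2SmoothForms.isSmoothForm_toForm o α
  have hφs := CL2SmoothForms.isSmoothForm_toForm o φ
  rw [CL2SmoothForms.inner_def, CL2SmoothForms.inner_def, CL2SmoothForms.toForm_mk]
  conv_lhs => rw [← sum_antidiagonal_typeComponent_holds (CL2SmoothForms.toForm o φ)]
  rw [MForm.cl2Inner_sum_right o ho h _ hαs _ (fun pq _ ↦ hφs.typeComponent pq.1 pq.2), Finset.sum_eq_single (p, q)]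
  · rintro ⟨a, b⟩ hab hne
    rw [mem_antidiagonal] at hab
    dsimp only at hab ⊢
    have hw : ((p : ℤ) - q : ℤ) ≠ (a : ℤ) - b := by
      intro hpw
      apply hne
      have h1 : a = p := by omega
      have h2 : b = q := by omega
      rw [h1, h2]
    exact MForm.cl2Inner_eq_zero_of_weight_ne o hH ho h hw hαs (hφs.typeComponent a b)
      hα.apply_comp_tangentRotate (isOfType_typeComponent_holds hab _).apply_comp_tangentRotate
  · intro habs
    exact (habs (mem_antidiagonal.2 (rfl : (p, q).1 + (p, q).2 = p + q))).elim

/-- The type component of a form of type `(p,q)` is the form. [folklore] -/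
theorem CL2SmoothForms.mk_typeComponent_of_mem {p q : ℕ} {α : CL2SmoothForms o (p + q)} (hα : α ∈ CL2SmoothForms.pq o p q) :
    CL2SmoothForms.mk o ((CL2SmoothForms.toForm o α).typeComponent p q)
      ((CL2SmoothForms.isSmoothForm_toForm o α).typeComponent p q) = α := by
  apply (CL2SmoothForms.toForm_inj o).1
  rw [CL2SmoothForms.toForm_mk]
  exact ((CL2SmoothForms.mem_pq_iff o α).1 hα).typeComponent_eq_self

/-- The type component lies in `A^{p,q}`. [folklore] -/
theorem CL2SmoothForms.mk_typeComponent_mem (p q : ℕ) (φ : CL2SmoothForms o (p + q)) :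
    CL2SmoothForms.mk o ((CL2SmoothForms.toForm o φ).typeComponent p q)
      ((CL2SmoothForms.isSmoothForm_toForm o φ).typeComponent p q) ∈ CL2SmoothForms.pq o p q := by
  rw [CL2SmoothForms.mem_pq_iff, CL2SmoothForms.toForm_mk]
  exact isOfType_typeComponent_holds rfl _

/-- **The type projection is `L²`-bounded** (norm `≤ 1`): `‖φ^{p,q}‖ ≤ ‖φ‖`. [cite: VoisinHodgeI2002, §5.1.1] -/
theorem CL2SmoothForms.norm_mk_typeComponent_le
    (hH : ∀ (x : M) (v w : TangentSpace 𝓘(ℝ, E) x), inner ℝ (tangentJ E x v) (tangentJ E x w) = inner ℝ v w)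
    {p q : ℕ} (h : (p + q) + m = n) (φ : CL2SmoothForms o (p + q)) :
    ‖CL2SmoothForms.mk o ((CL2SmoothForms.toForm o φ).typeComponent p q)
      ((CL2SmoothForms.isSmoothForm_toForm o φ).typeComponent p q)‖ ≤ ‖φ‖ := by
  set P : CL2SmoothForms o (p + q) := CL2SmoothForms.mk o ((CL2SmoothForms.toForm o φ).typeComponent p q)
    ((CL2SmoothForms.isSmoothForm_toForm o φ).typeComponent p q) with hP
  have hPmem : P ∈ CL2SmoothForms.pq o p q := CL2SmoothForms.mk_typeComponent_mem o p q φ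
  have h1 : ⟪P, φ⟫ = ⟪P, P⟫ := CL2SmoothForms.inner_eq_inner_typeComponent o hH h hPmem φ
  have h2 : ‖P‖ ^ 2 = (⟪P, φ⟫).re := by rw [h1, ← inner_self_eq_norm_sq (𝕜 := ℂ)]; rfl
  have h3 : (⟪P, φ⟫).re ≤ ‖P‖ * ‖φ‖ := by simpa using re_inner_le_norm (𝕜 := ℂ) P φ
  have hP0 : 0 ≤ ‖P‖ := norm_nonneg _
  by_cases hz : ‖P‖ = 0
  · rw [hz]; exact norm_nonneg _
  · have hpos : 0 < ‖P‖ := lt_of_le_of_ne hP0 (Ne.symm hz)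
    nlinarith [h2, h3]

/-- `⟪a, φ^{p,q}⟫ = ⟪a, φ⟫` for `a ∈ A^{p,q}`. [folklore] -/
theorem CL2SmoothForms.inner_mk_typeComponent_of_mem
    (hH : ∀ (x : M) (v w : TangentSpace 𝓘(ℝ, E) x), inner ℝ (tangentJ E x v) (tangentJ E x w) = inner ℝ v w)
    {p q : ℕ} (h : (p + q) + m = n) {a : CL2SmoothForms o (p + q)} (ha : a ∈ CL2SmoothForms.pq o p q)
    (φ : CL2SmoothForms o (p + q)) :
    ⟪a, CL2SmoothForms.mk o ((CL2SmoothForms.toForm o φ).typeComponent p q)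
      ((CL2SmoothForms.isSmoothForm_toForm o φ).typeComponent p q)⟫ = ⟪a, φ⟫ :=
  (CL2SmoothForms.inner_eq_inner_typeComponent o hH h ha φ).symm

/-- **The type projection commutes with `Δ_∂̄`** (from symmetry of `Δ_∂̄`, its invariance of
`A^{p,q}` and the orthogonality of types). [cite: VoisinHodgeI2002, §5.1.4] -/
theorem CL2SmoothForms.mk_typeComponent_dolbeaultLaplacian
    (hH : ∀ (x : M) (v w : TangentSpace 𝓘(ℝ, E) x), inner ℝ (tangentJ E x v) (tangentJ E x w) = inner ℝ v w)
    {p q : ℕ} (h : (p + q) + m = n) (φ : CL2SmoothForms o (p + q)) :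
    CL2SmoothForms.mk o ((CL2SmoothForms.toForm o (CL2SmoothForms.dolbeaultLaplacian o h φ)).typeComponent p q)
        ((CL2SmoothForms.isSmoothForm_toForm o _).typeComponent p q) =
      CL2SmoothForms.dolbeaultLaplacian o h (CL2SmoothForms.mk o ((CL2SmoothForms.toForm o φ).typeComponent p q)
        ((CL2SmoothForms.isSmoothForm_toForm o φ).typeComponent p q)) := by
  haveI : IsContinuousRiemannianBundle E (fun x : M ↦ TangentSpace 𝓘(ℝ, E) x) :=
    isContinuousRiemannianBundle_of_isContMDiffRiemannianBundle 𝓘(ℝ, E) ∞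
  have hsymm := CL2SmoothForms.dolbeaultLaplacian_isSymmetric o hH h (k := p + q)
  set P := fun ψ : CL2SmoothForms o (p + q) ↦ CL2SmoothForms.mk o ((CL2SmoothForms.toForm o ψ).typeComponent p q)
    ((CL2SmoothForms.isSmoothForm_toForm o ψ).typeComponent p q) with hP
  have hPmem : ∀ ψ, P ψ ∈ CL2SmoothForms.pq o p q := fun ψ ↦ CL2SmoothForms.mk_typeComponent_mem o p q ψ
  have hΔmem : ∀ ψ, CL2SmoothForms.dolbeaultLaplacian o h (P ψ) ∈ CL2SmoothForms.pq o p q := fun ψ ↦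
    CL2SmoothForms.dolbeaultLaplacian_mem_pq o hH h _ (hPmem ψ)
  change P (CL2SmoothForms.dolbeaultLaplacian o h φ) = CL2SmoothForms.dolbeaultLaplacian o h (P φ)
  refine ext_inner_right ℂ fun ψ ↦ ?_
  -- both sides pair with `ψ` to `⟪P φ, Δ (P ψ)⟫`
  have hl : ⟪P (CL2SmoothForms.dolbeaultLaplacian o h φ), ψ⟫ = ⟪P φ, CL2SmoothForms.dolbeaultLaplacian o h (P ψ)⟫ := by
    have h1 : ⟪P (CL2SmoothForms.dolbeaultLaplacian o h φ), ψ⟫ =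
        ⟪P (CL2SmoothForms.dolbeaultLaplacian o h φ), P ψ⟫ :=
      (CL2SmoothForms.inner_mk_typeComponent_of_mem o hH h (hPmem _) ψ).symm
    have h2 : ⟪P (CL2SmoothForms.dolbeaultLaplacian o h φ), P ψ⟫ = ⟪CL2SmoothForms.dolbeaultLaplacian o h φ, P ψ⟫ := by
      rw [← inner_conj_symm, CL2SmoothForms.inner_mk_typeComponent_of_mem o hH h (hPmem ψ), inner_conj_symm]
    have h3 : ⟪CL2SmoothForms.dolbeaultLaplacian o h φ, P ψ⟫ = ⟪φ, CL2SmoothForms.dolbeaultLaplacian o h (P ψ)⟫ := hsymm φ (P ψ)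
    have h4 : ⟪φ, CL2SmoothForms.dolbeaultLaplacian o h (P ψ)⟫ = ⟪P φ, CL2SmoothForms.dolbeaultLaplacian o h (P ψ)⟫ := by
      rw [← inner_conj_symm, ← CL2SmoothForms.inner_mk_typeComponent_of_mem o hH h (hΔmem ψ) φ, inner_conj_symm]
    rw [h1, h2, h3, h4]
  have hr : ⟪CL2SmoothForms.dolbeaultLaplacian o h (P φ), ψ⟫ = ⟪P φ, CL2SmoothForms.dolbeaultLaplacian o h (P ψ)⟫ := by
    have h1 : ⟪CL2SmoothForms.dolbeaultLaplacian o h (P φ), ψ⟫ = ⟪CL2SmoothForms.dolbeaultLaplacian o h (P φ), P ψ⟫ :=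
      (CL2SmoothForms.inner_mk_typeComponent_of_mem o hH h (hΔmem φ) ψ).symm
    rw [h1, hsymm (P φ) (P ψ)]
  rw [hl, hr]

/-- **Warner's Theorem 6.5 for `Δ_∂̄` on `A^{p,q}(M)`**: a bounded weak solution
`ℓ(Δ_∂̄ φ) = ⟪α, φ⟫` on `A^{p,q}(M)` is represented, `ℓ = ⟪w, ·⟫` with `w ∈ A^{p,q}(M)` — the
regularity hypothesis `hR` of the elliptic reduction of the Frölicher inequality (extend `ℓ` by the
`L²`-bounded type projection, represent on `A^{p+q}(M; ℂ)`, project back). [cite: WarnerGTM94, Thm. 6.5] -/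
theorem CL2SmoothForms.pq_regular
    (hH : ∀ (x : M) (v w : TangentSpace 𝓘(ℝ, E) x), inner ℝ (tangentJ E x v) (tangentJ E x w) = inner ℝ v w)
    (p q : ℕ) (h : (p + q) + m = n) (α : CL2SmoothForms.pq o p q) (ℓ : CL2SmoothForms.pq o p q →L[ℂ] ℂ)
    (hweak : ∀ φ, ℓ (CL2SmoothForms.pqLaplacian o hH p q h φ) = ⟪α, φ⟫) :
    ∃ w : CL2SmoothForms.pq o p q, ∀ φ, ℓ φ = ⟪w, φ⟫ := by
  -- the type projection as a continuous linear map
  let Pl : CL2SmoothForms o (p + q) →ₗ[ℂ] CL2SmoothForms.pq o p q :=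
    { toFun := fun φ ↦ ⟨CL2SmoothForms.mk o ((CL2SmoothForms.toForm o φ).typeComponent p q)
        ((CL2SmoothForms.isSmoothForm_toForm o φ).typeComponent p q), CL2SmoothForms.mk_typeComponent_mem o p q φ⟩
      map_add' := fun φ ψ ↦ by
        apply Subtype.ext
        apply (CL2SmoothForms.toForm_inj o).1
        simp only [Submodule.coe_add, CL2SmoothForms.toForm_mk, CL2SmoothForms.toForm_add, MForm.typeComponent_add]
      map_smul' := fun c φ ↦ by
        apply Subtype.ext
        apply (CL2SmoothForms.toForm_inj o).1
        simp only [Submodule.coe_smul, CL2SmoothForms.toForm_mk, CL2SmoothForms.toForm_smul, MForm.typeComponent_smul,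
          RingHom.id_apply] }
  have hPl : ∀ φ, ((Pl φ : CL2SmoothForms.pq o p q) : CL2SmoothForms o (p + q)) =
      CL2SmoothForms.mk o ((CL2SmoothForms.toForm o φ).typeComponent p q)
        ((CL2SmoothForms.isSmoothForm_toForm o φ).typeComponent p q) := fun _ ↦ rfl
  let Pr : CL2SmoothForms o (p + q) →L[ℂ] CL2SmoothForms.pq o p q := Pl.mkContinuous 1 fun φ ↦ by
    rw [one_mul, Submodule.coe_norm, hPl]; exact CL2SmoothForms.norm_mk_typeComponent_le o hH h φ
  have hPr : ∀ φ, ((Pr φ : CL2SmoothForms.pq o p q) : CL2SmoothForms o (p + q)) =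
      CL2SmoothForms.mk o ((CL2SmoothForms.toForm o φ).typeComponent p q)
        ((CL2SmoothForms.isSmoothForm_toForm o φ).typeComponent p q) := fun _ ↦ rfl
  have hPr_mem : ∀ φ : CL2SmoothForms.pq o p q, Pr (φ : CL2SmoothForms o (p + q)) = φ := fun φ ↦
    Subtype.ext (by rw [hPr]; exact CL2SmoothForms.mk_typeComponent_of_mem o φ.2)
  have hPrΔ : ∀ φ, Pr (CL2SmoothForms.dolbeaultLaplacian o h φ) =
      CL2SmoothForms.pqLaplacian o hH p q h (Pr φ) := fun φ ↦
    Subtype.ext (by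
      rw [hPr]
      change _ = CL2SmoothForms.dolbeaultLaplacian o h ((Pr φ : CL2SmoothForms.pq o p q) : CL2SmoothForms o (p + q))
      rw [hPr]; exact CL2SmoothForms.mk_typeComponent_dolbeaultLaplacian o hH h φ)
  -- the extended functional is a weak solution on `A^{p+q}(M; ℂ)`
  set ℓ' : CL2SmoothForms o (p + q) →L[ℂ] ℂ := ℓ.comp Pr with hℓ'
  have hweak' : ∀ φ, ℓ' (CL2SmoothForms.dolbeaultLaplacian o h φ) = ⟪(α : CL2SmoothForms o (p + q)), φ⟫ := fun φ ↦ by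
    rw [hℓ', ContinuousLinearMap.comp_apply, hPrΔ, hweak, Submodule.coe_inner, hPr,
      CL2SmoothForms.inner_mk_typeComponent_of_mem o hH h α.2]
  obtain ⟨w, hw⟩ := CL2SmoothForms.dolbeaultLaplacian_regular_all o hH (p + q) m h (α : CL2SmoothForms o (p + q)) ℓ' hweak'
  refine ⟨Pr w, fun φ ↦ ?_⟩
  have h1 : ℓ φ = ℓ' (φ : CL2SmoothForms o (p + q)) := by
    rw [hℓ', ContinuousLinearMap.comp_apply, hPr_mem]
  rw [h1, hw, Submodule.coe_inner, hPr, ← inner_conj_symm,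
    ← CL2SmoothForms.inner_mk_typeComponent_of_mem o hH h φ.2 w, inner_conj_symm]

end Literature.Geometry.Kaehler
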